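import Mathlib
import Literature.Geometry.Lorentzian.LorentzianMetric
import Literature.Geometry.Lorentzian.Geodesic
import Literature.Geometry.Lorentzian.GeodesicMaximal
import Literature.Geometry.Lorentzian.GeodesicMaximalFlow
import Literature.Geometry.Lorentzian.GeodesicRayEndpoint
import Literature.Geometry.Lorentzian.GeodesicExtension
import Literature.Geometry.Lorentzian.GeodesicIncompleteness
import Literature.Geometry.Lorentzian.LeviCivitaProofs
import Literature.Geometry.Lorentzian.Causality

/-!
# Route PhotonSphereChannels · crux `TameCensorship` (stmt-FinalStateConjecture-17431) · line `Sketch`, skeleton v6 ·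
# stub `stub_maximalGeodesic_isFutureEndless`: a maximal incomplete geodesic has no future endpoint

Helper file (`--supports stmt-FinalStateConjecture-17431`) of line `Sketch` (lead c2, 2026-08-17), a brick of the
PANCAKE LAW (alternative route to clause (a) of K3): Step 1 of its proof needs that a MAXIMAL geodesic `γ` of the
Levi-Civita connection of a spacetime, with parameter domain `dom` bounded above and non-zero velocity, restricted
to a final segment `dom ∩ [t₀, ∞) = [t₀, sup dom)`, has NO FUTURE ENDPOINT (`IsFutureEndless`), so that the
non-imprisonment lemma of causality theory applies to it. This is O'Neill 1983, Ch. 5, Lemma 8 (p. 130): a geodesic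
on `[0, b)`, `b < ∞`, which is continuously extendible to `b` is extendible to `b` as a geodesic — absurd for a
maximal one.

Proof (the uniformly-normal-neighbourhood argument of `Literature.Geometry.Lorentzian.GeodesicRayEndpoint`, the
complete case, transplanted to a bounded parameter domain): let `z` be a would-be endpoint, `b = sup dom ∉ dom`, and
`W ∋ z` a uniformly normal neighbourhood with two-point inverse `Ξ(q, ·) = exp_q⁻¹` on the open set `Src` of small
vectors (`Literature.Geometry.Riemannian.exists_twoPoint_expInverse`; Lee 2018, Prop. 5.19 (e)). From a parameter
`t₂ ∈ dom` on `γ ⊂ W`; re-based at `q = γ t₂`, `w = γ' t₂ ≠ 0`, the translate `u ↦ γ (u + t₂)` IS the maximal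
geodesic `γ_w` (`IsMaximalGeodesicOn.comp_add`, `maximalGeodesic_unique`), so `γ (s + t₂) = exp_q (s w)` for
`0 ≤ s < S := b - t₂` (Lee, Prop. 5.19 (b), `expMap_smul_of_mem`), and by injectivity on `Src` plus a continuity
(infimum) argument `s w = Ξ(q, γ (s + t₂))` for all these `s`. Letting `s ↑ S`: `S w = Ξ(q, z)`, a small vector,
hence `S w ∈ 𝓔_q`, i.e. `S ∈ dom γ_w = dom - t₂` (`mem_maximalGeodesicDomain_iff_smul_mem_expDomain`), i.e.
`b ∈ dom` — contradiction.

References: B. O'Neill, *Semi-Riemannian Geometry* (1983), Ch. 5, Lemma 8 (p. 130) and Ch. 3, Prop. 24 (p. 68);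
J. M. Lee, *Introduction to Riemannian Manifolds* (2018), Prop. 5.19 (b), (e), Lemma 6.19; S. W. Hawking,
G. F. R. Ellis, *The large scale structure of space-time* (1973), §6.2 (endpoints), §6.4 (non-imprisonment), §8.1.
-/

set_option linter.dupNamespace false

open Literature.Geometry.Lorentzian Literature.Geometry.Riemannian
open scoped Manifold ContDiff Topology
open Set Filter Function Bundle

noncomputable section

namespace Summit.FinalStateConjecture.FinalStateConjecture.Theorems.PhotonSphereChannels.TameCensorshipUnwind

section Connection

variable {E : Type*} [NormedAddCommGroup E] [NormedSpace ℝ E] {H : Type*} [TopologicalSpace H]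
  {I : ModelWithCorners ℝ E H} {M : Type*} [TopologicalSpace M] [ChartedSpace H M]
  [IsManifold I ∞ M] [FiniteDimensional ℝ E] [CompleteSpace E] [T2Space M] [I.Boundaryless]
  {cov : CovariantDerivative I E (TangentSpace I : M → Type _)}
  [CovariantDerivative.ContMDiffCovariantDerivative cov 1]
  [CovariantDerivative.ContMDiffCovariantDerivative cov (⊤ : ℕ∞)]

/-- **A maximal geodesic with parameter domain bounded above has no future endpoint** (connection level; O'Neill
1983, Ch. 5, Lemma 8, p. 130: continuous extendibility to `b = sup dom` forces geodesic extendibility). For a `C^∞`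
connection on a Hausdorff manifold without boundary, if `γ` is a maximal geodesic on `dom` (bounded above) with
`γ' t₀ ≠ 0`, `t₀ ∈ dom`, then no `z` is a future endpoint of `γ` on `dom ∩ [t₀, ∞)`. See the module docstring for
the proof (uniformly normal neighbourhood of `z`, two-point inverse of `exp`, and uniqueness of maximal geodesics).
[cite: ONeillSemiRiemannian1983, Ch. 5, Lemma 8 (p. 130)] -/
private theorem tameCensorship_not_hasFutureEndpoint_of_isMaximalGeodesicOn {γ : ℝ → M} {dom : Set ℝ}
    (hmax : IsMaximalGeodesicOn cov γ dom) (hbdd : BddAbove dom) {t₀ : ℝ} (ht₀ : t₀ ∈ dom)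
    (hv : velocity I γ t₀ ≠ 0) (z : M) : ¬ HasFutureEndpoint γ (dom ∩ Ici t₀) z := by
  intro hend
  haveI : BoundarylessManifold I M := inferInstance
  have hopen : IsOpen dom := hmax.1
  have hord : dom.OrdConnected := hmax.2.1
  have hgeo : IsGeodesicOn cov γ dom := hmax.isGeodesicOn
  -- Step 0: `b = sup dom ∉ dom`, and `[t, b) ⊆ dom` for `t ∈ dom`
  have hne : dom.Nonempty := ⟨t₀, ht₀⟩
  set b := sSup dom with hb
  have hltb : ∀ t ∈ dom, t < b := by
    intro t ht
    obtain ⟨ε, hε, hball⟩ := Metric.isOpen_iff.1 hopen t ht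
    have h1 : t + ε / 2 ∈ dom := hball (by
      rw [Metric.mem_ball, Real.dist_eq, add_sub_cancel_left, abs_of_pos (half_pos hε)]
      exact half_lt_self hε)
    have h2 := le_csSup hbdd h1
    linarith
  have hmem_of : ∀ t ∈ dom, ∀ u, t ≤ u → u < b → u ∈ dom := by
    intro t ht u htu hub
    obtain ⟨t', ht', hut'⟩ := exists_lt_of_lt_csSup hne hub
    exact hord.out ht ht' ⟨htu, hut'.le⟩
  have hbnot : b ∉ dom := fun h ↦ lt_irrefl b (hltb b h)
  -- Hawking–Ellis' wording of the endpoint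
  have hHE := (hasFutureEndpoint_iff (⟨t₀, ht₀, self_mem_Ici⟩ : (dom ∩ Ici t₀).Nonempty)).1 hend
  -- Step 1: the uniformly normal neighbourhood of `z`
  obtain ⟨W, Src, Ξ, hWo, hzW, hWch, hSo, hW0, hSrcE, hinj, hinv, hΞs, -⟩ :=
    exists_twoPoint_expInverse (cov := cov) z
  set e := trivializationAt E (TangentSpace I : M → Type _) z with he
  -- Step 2: eventually `γ` lies in `W`; re-base at such a parameter `t₂ ∈ dom`, `t₂ ≥ t₀`
  obtain ⟨t₂, ht₂dom, ht₀₂, ht₂W⟩ : ∃ t₂ ∈ dom, t₀ ≤ t₂ ∧ ∀ t ∈ dom, t₂ ≤ t → γ t ∈ W := by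
    obtain ⟨t₂, ⟨ht₂dom, ht₀₂⟩, h⟩ := hHE W (hWo.mem_nhds hzW)
    exact ⟨t₂, ht₂dom, ht₀₂, fun t ht h₂t ↦ h t ⟨ht, le_trans (mem_Ici.1 ht₀₂) h₂t⟩ h₂t⟩
  have ht₂b : t₂ < b := hltb t₂ ht₂dom
  set S : ℝ := b - t₂ with hS
  have hSpos : 0 < S := sub_pos.2 ht₂b
  have hsdom : ∀ s : ℝ, 0 ≤ s → s < S → s + t₂ ∈ dom := fun s hs hsS ↦
    hmem_of t₂ ht₂dom (s + t₂) (by linarith) (by linarith)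
  set q : M := γ t₂ with hq
  set w : TangentSpace I q := velocity I γ t₂ with hw
  have hw0 : w ≠ 0 := hgeo.velocity_ne_zero hopen hord ht₀ hv ht₂dom
  -- the translate `u ↦ γ (u + t₂)` is THE maximal geodesic `γ_w` with data `(q, w)`
  have htr : IsMaximalGeodesicOn cov (fun u ↦ γ (u - (-t₂))) {u | u + t₂ ∈ dom} := hmax.comp_add t₂
  have h0tr : (0 : ℝ) ∈ {u : ℝ | u + t₂ ∈ dom} := by
    show (0 : ℝ) + t₂ ∈ dom
    rw [zero_add]
    exact ht₂dom
  have hxtr : (fun u ↦ γ (u - (-t₂))) 0 = q := by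
    show γ (0 - (-t₂)) = γ t₂
    rw [zero_sub, neg_neg]
  have hvtr : velocity I (fun u ↦ γ (u - (-t₂))) 0 = w := by
    rw [velocity_comp_sub_const γ (-t₂) 0, zero_sub, neg_neg]
  obtain ⟨hdomeq, heqtr⟩ := maximalGeodesic_unique htr h0tr hxtr hvtr
  -- Step 3: `γ (s + t₂) = exp_q (s w)` for `0 ≤ s < S`
  have hexp : ∀ s : ℝ, 0 ≤ s → s < S →
      s • w ∈ expDomain cov q ∧ expMap cov q (s • w) = γ (s + t₂) := by
    intro s hs hsS
    have hsD : s ∈ maximalGeodesicDomain cov q w := by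
      rw [← hdomeq]
      exact hsdom s hs hsS
    obtain ⟨h1, h2⟩ := expMap_smul_of_mem (cov := cov) q w hsD
    refine ⟨h1, ?_⟩
    rw [h2, ← heqtr (show s ∈ {u : ℝ | u + t₂ ∈ dom} from hsdom s hs hsS)]
    show γ (s - (-t₂)) = γ (s + t₂)
    rw [sub_neg_eq_add]
  have hqW : q ∈ W := ht₂W t₂ ht₂dom le_rfl
  have hγW : ∀ s : ℝ, 0 ≤ s → s < S → γ (s + t₂) ∈ W := fun s hs hsS ↦
    ht₂W _ (hsdom s hs hsS) (by linarith)
  have hqb : q ∈ e.baseSet := by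
    rw [he, TangentBundle.trivializationAt_baseSet]
    exact hWch hqW
  -- Step 4: the two coordinate descriptions of the segment
  set ξ : ℝ → E := fun s ↦ s • e.continuousLinearMapAt ℝ q w with hξ
  set ζ : ℝ → E := fun s ↦ Ξ q (γ (s + t₂)) with hζ
  have hsymm : ∀ s, e.symmL ℝ q (ξ s) = s • w := by
    intro s
    show e.symmL ℝ q (s • e.continuousLinearMapAt ℝ q w) = s • w
    rw [map_smul, Trivialization.symmL_continuousLinearMapAt _ hqb]
  have hFξ : ∀ s : ℝ, 0 ≤ s → s < S → expMap cov q (e.symmL ℝ q (ξ s)) = γ (s + t₂) :=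
    fun s hs hsS ↦ by
    rw [hsymm]
    exact (hexp s hs hsS).2
  have hFζ : ∀ s : ℝ, 0 ≤ s → s < S →
      (q, ζ s) ∈ Src ∧ expMap cov q (e.symmL ℝ q (ζ s)) = γ (s + t₂) :=
    fun s hs hsS ↦ hinv q hqW _ (hγW s hs hsS)
  have hξζ : ∀ s : ℝ, 0 ≤ s → s < S → (q, ξ s) ∈ Src → ξ s = ζ s := by
    intro s hs hsS hmem
    have h := hinj hmem (hFζ s hs hsS).1 (by
      show (q, expMap cov q (e.symmL ℝ q (ξ s))) = (q, expMap cov q (e.symmL ℝ q (ζ s)))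
      rw [hFξ s hs hsS, (hFζ s hs hsS).2])
    exact (Prod.ext_iff.1 h).2
  -- Step 5: continuity of the two descriptions
  have hξc : Continuous ξ := continuous_id.smul continuous_const
  have hγc : ∀ s : ℝ, 0 ≤ s → s < S → ContinuousAt (fun s : ℝ ↦ γ (s + t₂)) s := by
    intro s hs hsS
    have h1 : ContinuousAt γ (s + t₂) :=
      (IsGeodesicOn.mdifferentiableAt_holds hgeo (hsdom s hs hsS)).continuousAt
    have h2 : ContinuousAt (fun s : ℝ ↦ s + t₂) s := (continuous_add_const t₂).continuousAt
    exact ContinuousAt.comp (g := γ) (f := fun s : ℝ ↦ s + t₂) h1 h2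
  have hΞcont : ∀ y ∈ W, ContinuousAt (Ξ q) y := by
    intro y hy
    have h1 : ContinuousAt (uncurry Ξ) (q, y) :=
      hΞs.continuousOn.continuousAt ((hWo.prod hWo).mem_nhds ⟨hqW, hy⟩)
    exact h1.comp (continuousAt_const.prodMk continuousAt_id)
  have hζc : ∀ s : ℝ, 0 ≤ s → s < S → ContinuousAt ζ s := fun s hs hsS ↦
    ContinuousAt.comp (g := Ξ q) (f := fun s : ℝ ↦ γ (s + t₂)) (hΞcont _ (hγW s hs hsS))
      (hγc s hs hsS)
  have hnbhd : ∀ s₀ : ℝ, (q, ξ s₀) ∈ Src → ∃ δ > 0, ∀ s, |s - s₀| < δ → (q, ξ s) ∈ Src := by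
    intro s₀ hmem
    have hc : Continuous fun s : ℝ ↦ ((q, ξ s) : M × E) := continuous_const.prodMk hξc
    have h1 : ∀ᶠ s in 𝓝 s₀, (q, ξ s) ∈ Src := hc.continuousAt.eventually_mem (hSo.mem_nhds hmem)
    obtain ⟨δ, hδ, h⟩ := Metric.eventually_nhds_iff.1 h1
    exact ⟨δ, hδ, fun s hs ↦ h (by rwa [Real.dist_eq])⟩
  -- Step 6: the whole segment is read by small vectors: `(q, ξ s) ∈ Src` for `0 ≤ s < S`
  have hall : ∀ s : ℝ, 0 ≤ s → s < S → (q, ξ s) ∈ Src := by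
    by_contra hcon
    push Not at hcon
    obtain ⟨s₁, hs₁, hs₁S, hs₁mem⟩ := hcon
    set B : Set ℝ := {s | 0 ≤ s ∧ s < S ∧ (q, ξ s) ∉ Src} with hB
    have hBne : B.Nonempty := ⟨s₁, hs₁, hs₁S, hs₁mem⟩
    have hBbdd : BddBelow B := ⟨0, fun s hs ↦ hs.1⟩
    set S₀ := sInf B with hS₀
    have hS₀S : S₀ < S := lt_of_le_of_lt (csInf_le hBbdd ⟨hs₁, hs₁S, hs₁mem⟩) hs₁S
    have hlt : ∀ s : ℝ, 0 ≤ s → s < S₀ → (q, ξ s) ∈ Src := fun s hs hsS₀ ↦ by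
      by_contra h
      exact (not_lt.2 (csInf_le hBbdd ⟨hs, lt_trans hsS₀ hS₀S, h⟩)) hsS₀
    have h0mem : (q, ξ 0) ∈ Src := by
      have : ξ 0 = 0 := zero_smul _ _
      rw [this]
      exact hW0 q hqW
    obtain ⟨δ, hδ, hδmem⟩ := hnbhd 0 h0mem
    have hδS₀ : δ ≤ S₀ := by
      refine le_csInf hBne fun b' hb' ↦ ?_
      by_contra h
      push Not at h
      exact hb'.2.2 (hδmem b' (by rw [abs_lt]; constructor <;> linarith [hb'.1]))
    have hS₀pos : 0 < S₀ := lt_of_lt_of_le hδ hδS₀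
    have hξS₀ : ξ S₀ = ζ S₀ := by
      have h1 : Tendsto ξ (𝓝[<] S₀) (𝓝 (ξ S₀)) := hξc.continuousAt.continuousWithinAt
      have h2 : Tendsto ζ (𝓝[<] S₀) (𝓝 (ζ S₀)) := (hζc S₀ hS₀pos.le hS₀S).continuousWithinAt
      have h3 : ξ =ᶠ[𝓝[<] S₀] ζ := by
        filter_upwards [Ioo_mem_nhdsLT hS₀pos] with s hs
        exact hξζ s hs.1.le (lt_trans hs.2 hS₀S) (hlt s hs.1.le hs.2)
      exact tendsto_nhds_unique (h1.congr' h3) h2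
    have hS₀mem : (q, ξ S₀) ∈ Src := by
      rw [hξS₀]
      exact (hFζ S₀ hS₀pos.le hS₀S).1
    obtain ⟨δ', hδ', hδ'mem⟩ := hnbhd S₀ hS₀mem
    obtain ⟨b', hb'B, hb'S₀⟩ := exists_lt_of_csInf_lt hBne (show sInf B < S₀ + δ' by linarith)
    have hS₀b' : S₀ ≤ b' := csInf_le hBbdd hb'B
    exact hb'B.2.2 (hδ'mem b' (by rw [abs_lt]; constructor <;> linarith))
  have heqξζ : ∀ s : ℝ, 0 ≤ s → s < S → ξ s = ζ s := fun s hs hsS ↦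
    hξζ s hs hsS (hall s hs hsS)
  -- Step 7: let `s ↑ S`: `ξ S = Ξ(q, z)` is a small vector, so `S w ∈ 𝓔_q`
  have hγlim : Tendsto (fun s : ℝ ↦ γ (s + t₂)) (𝓝[<] S) (𝓝 z) := by
    refine tendsto_def.2 fun V hV ↦ ?_
    obtain ⟨t, ⟨htdom, ht₀t⟩, hV'⟩ := hHE V hV
    have htb : t < b := hltb t htdom
    have hIoo : Ioo (t - t₂) S ∈ 𝓝[<] S := Ioo_mem_nhdsLT (by linarith)
    filter_upwards [hIoo] with s hs
    show γ (s + t₂) ∈ V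
    refine hV' (s + t₂) ⟨hmem_of t htdom _ (by linarith [hs.1]) (by linarith [hs.2]),
      mem_Ici.2 ?_⟩ (by linarith [hs.1])
    linarith [hs.1, mem_Ici.1 ht₀t]
  have hζlim : Tendsto ζ (𝓝[<] S) (𝓝 (Ξ q z)) := (hΞcont z hzW).tendsto.comp hγlim
  have hξlim : Tendsto ξ (𝓝[<] S) (𝓝 (ξ S)) := hξc.continuousAt.continuousWithinAt
  have hξS : ξ S = Ξ q z := by
    have h3 : ζ =ᶠ[𝓝[<] S] ξ := by
      filter_upwards [Ioo_mem_nhdsLT hSpos] with s hs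
      exact (heqξζ s hs.1.le hs.2).symm
    exact tendsto_nhds_unique hξlim (hζlim.congr' h3)
  have hSw : S • w ∈ expDomain cov q := by
    have h1 := (hSrcE _ (hinv q hqW z hzW).1).2
    rw [← hsymm S, hξS]
    exact h1
  -- conclusion: `S ∈ dom γ_w = dom - t₂`, i.e. `b ∈ dom`
  have hSD : S ∈ maximalGeodesicDomain cov q w :=
    (mem_maximalGeodesicDomain_iff_smul_mem_expDomain (cov := cov) q w S).2 hSw
  rw [← hdomeq] at hSD
  have hbdom : S + t₂ ∈ dom := hSD
  rw [hS, sub_add_cancel] at hbdom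
  exact hbnot hbdom

end Connection

/-- **Stub `stub_maximalGeodesic_isFutureEndless` of line `Sketch` (skeleton v6) for the crux
`PhotonSphereChannels.TameCensorship` (stmt-FinalStateConjecture-17431): A MAXIMAL INCOMPLETE GEODESIC IS FUTURE
ENDLESS.** In a spacetime `𝓢`, let `γ` be a maximal geodesic of the Levi-Civita connection with parameter domain
`dom` bounded above, `t₀ ∈ dom`, and `γ' t₀ ≠ 0`. Then `γ` has no future endpoint on `dom ∩ [t₀, ∞)`
(`IsFutureEndless`): the Levi-Civita connection of the `C^∞` metric is `C^∞`
(`isLocallyContMDiff_leviCivita_holds`), and the connection-level lemma applies (a would-be endpoint `z` has a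
uniformly normal neighbourhood in which, re-based at a late parameter `t₂`, `γ (s + t₂) = exp_q (s w)` with
`s w = exp_q⁻¹ (γ (s + t₂)) → exp_q⁻¹ z` as `s ↑ sup dom - t₂`, so `γ_w` is defined at `sup dom - t₂` and
`sup dom ∈ dom` by uniqueness of maximal geodesics — absurd). O'Neill 1983, Ch. 5, Lemma 8 (p. 130); Lee 2018,
Prop. 5.19 (b), (e); Hawking–Ellis 1973, §6.2, §8.1. [cite: ONeillSemiRiemannian1983, Ch. 5, Lemma 8 (p. 130)] -/
theorem stub_maximalGeodesic_isFutureEndless :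
    ∀ (𝓢 : Spacetime.{0} 4) [𝓢.metric.HasLeviCivita] (γ : ℝ → 𝓢.carrier) (dom : Set ℝ) (t₀ : ℝ),
    IsMaximalGeodesicOn 𝓢.metric.leviCivita γ dom → BddAbove dom → t₀ ∈ dom →
    velocity (𝓡 4) γ t₀ ≠ 0 → IsFutureEndless γ (dom ∩ Set.Ici t₀) := by
  intro 𝓢 _ γ dom t₀ hmax hbdd ht₀ hv
  -- the Levi-Civita connection of the `C^∞` metric is `C¹` and `C^∞`
  haveI : CovariantDerivative.ContMDiffCovariantDerivative 𝓢.metric.leviCivita 1 :=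
    ⟨𝓢.metric.isLocallyContMDiff_leviCivita_holds 1 (by exact_mod_cast le_top) univ isOpen_univ⟩
  haveI : CovariantDerivative.ContMDiffCovariantDerivative 𝓢.metric.leviCivita (⊤ : ℕ∞) :=
    ⟨𝓢.metric.isLocallyContMDiff_leviCivita_holds ⊤ (by exact_mod_cast le_top) univ isOpen_univ⟩
  exact ⟨⟨t₀, ht₀, self_mem_Ici⟩, fun z ↦
    tameCensorship_not_hasFutureEndpoint_of_isMaximalGeodesicOn hmax hbdd ht₀ hv z⟩

end Summit.FinalStateConjecture.FinalStateConjecture.Theorems.PhotonSphereChannels.TameCensorshipUnwind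

end
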